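import Summits.AnomalousDissipation.AnomalousDissipation.Theorems.TaylorCertificatePair.Negative.ModesFourier

/-!
# An orthogonal integer frame adapted to the beat frequency; the unresolved wave frequencies

Crux `TaylorCertificates.TaylorCertificatePair` (stmt-AnomalousDissipation-13037), negative side
(cdisprove seat `refuter-cdisprove-stmt-AnomalousDissipation-13037-0`): support for the refutation
`Theorems/TaylorCertificatesTaylorCertificatePairRefutation.lean` (CEILING killed by an unresolved beat).
All statements are written over the tree's objects directly (no new definitions): single real modes
`Torus.realTrigPoly {k} (fun _ => z) = Re (e_k • z)`, mode sums `∑ₘ Torus.realTrigPoly {k m} (fun _ => z m)`,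
Fourier coefficients `mFourierCoeff (complexify ∘ ·)`, the transversal products `(fun j => (κ j : ℂ)) ⬝ᵥ z`.

* `gram_identity` / `frame_identity` (Lagrange–Gram for the triple product) and `frame_selection`: for `q ≠ 0` and a
  complex vector `g ⊥ q`, an integer direction `r ⊥ q` (length `≤ |q|²`) and a real unit `B̂ ⊥ r, q` with
  `2|⟪g, B̂⟫|² ≥ ‖g‖²` (frame `rₐ = (q₁,−q₀,0)` or `(0,q₂,−q₁)`, `r_b = q × rₐ`);
* `wave_frequencies`: a multiple `p` of `r` with `p ⊥ q`, `|p| ≥ 2N+4`, `|p|, |p+q| ≤ N²+2N+5`, and all the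
  combinations with `±e₂` outside the ball of radius `N`.
-/

noncomputable section

open MeasureTheory UnitAddTorus Matrix
open scoped InnerProductSpace ENNReal ComplexConjugate

namespace Summit.AnomalousDissipation.AnomalousDissipation.Theorems.TaylorCertificatePair.Negative

open Literature.Analysis.FunctionSpaces Literature.Analysis.FluidPDE

/-! ### Gram / frame identities in `ℝ³` -/

/-- Lagrange–Gram identity for the triple product, specialised to `v ⊥ q`, `a ⊥ q`:
`(v·a)² |q|² + (v·(q × a))² = |v|² |q|² |a|²`. -/
theorem gram_identity (v q a : Fin 3 → ℝ) (hv : v ⬝ᵥ q = 0) (ha : a ⬝ᵥ q = 0) :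
    (v ⬝ᵥ a) ^ 2 * (q ⬝ᵥ q) + (v ⬝ᵥ (q ⨯₃ a)) ^ 2 = (v ⬝ᵥ v) * (q ⬝ᵥ q) * (a ⬝ᵥ a) := by
  simp only [dotProduct, Fin.sum_univ_three, cross_apply, Matrix.cons_val_zero, Matrix.cons_val_one,
    Matrix.cons_val_two, Matrix.head_cons, Matrix.tail_cons] at hv ha ⊢
  linear_combination (2 * (q 0 * a 0 + q 1 * a 1 + q 2 * a 2) * (a 0 * v 0 + a 1 * v 1 + a 2 * v 2) -
    (a 0 * a 0 + a 1 * a 1 + a 2 * a 2) * (v 0 * q 0 + v 1 * q 1 + v 2 * q 2)) * hv +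
    (-(v 0 * v 0 + v 1 * v 1 + v 2 * v 2) * (q 0 * a 0 + q 1 * a 1 + q 2 * a 2)) * ha

/-- Norm of the cross product of orthogonal vectors. -/
theorem cross_self_dot (q a : Fin 3 → ℝ) (ha : a ⬝ᵥ q = 0) :
    (q ⨯₃ a) ⬝ᵥ (q ⨯₃ a) = (q ⬝ᵥ q) * (a ⬝ᵥ a) := by
  rw [cross_dot_cross, dotProduct_comm q a, ha]; ring

/-- Parseval in the orthogonal frame `{a, q × a}` of `q⊥`: for `v ⊥ q`,
`(v·a)² |b|² + (v·b)² |a|² = |v|² |a|² |b|²` with `b = q × a`. -/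
theorem frame_identity (v q a : Fin 3 → ℝ) (hv : v ⬝ᵥ q = 0) (ha : a ⬝ᵥ q = 0) :
    (v ⬝ᵥ a) ^ 2 * ((q ⨯₃ a) ⬝ᵥ (q ⨯₃ a)) + (v ⬝ᵥ (q ⨯₃ a)) ^ 2 * (a ⬝ᵥ a) =
      (v ⬝ᵥ v) * (a ⬝ᵥ a) * ((q ⨯₃ a) ⬝ᵥ (q ⨯₃ a)) := by
  have hg := gram_identity v q a hv ha
  rw [cross_self_dot q a ha]
  linear_combination (a ⬝ᵥ a) * hg

/-! ### The integer frame -/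

/-- `ra q ⊥ q`. -/
theorem ra_dot (q : Fin 3 → ℤ) : (if (q) 0 ≠ 0 ∨ (q) 1 ≠ 0 then (![(q) 1, -(q) 0, 0] : Fin 3 → ℤ) else (![0, (q) 2, -(q) 1] : Fin 3 → ℤ)) ⬝ᵥ q = 0 := by
  split_ifs <;> simp [dotProduct, Fin.sum_univ_three] <;> ring

/-- `ra q ≠ 0` for `q ≠ 0`. -/
theorem ra_ne_zero {q : Fin 3 → ℤ} (hq : q ≠ 0) : (if (q) 0 ≠ 0 ∨ (q) 1 ≠ 0 then (![(q) 1, -(q) 0, 0] : Fin 3 → ℤ) else (![0, (q) 2, -(q) 1] : Fin 3 → ℤ)) ≠ 0 := by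
  split_ifs with h
  · intro h0
    rcases h with h | h
    · exact h (by simpa using congrFun h0 1)
    · exact h (by simpa using congrFun h0 0)
  · push Not at h
    intro h0
    apply hq
    have h2 : q 2 = 0 := by simpa using congrFun h0 1
    funext i
    fin_cases i <;> simp [h.1, h.2, h2]

/-- `rb q ⊥ q`. -/
theorem rb_dot_q (q : Fin 3 → ℤ) : ((q) ⨯₃ (if (q) 0 ≠ 0 ∨ (q) 1 ≠ 0 then (![(q) 1, -(q) 0, 0] : Fin 3 → ℤ) else (![0, (q) 2, -(q) 1] : Fin 3 → ℤ))) ⬝ᵥ q = 0 := by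
  rw [dotProduct_comm]; exact dot_self_cross q _

/-- `rb q ⊥ ra q`. -/
theorem rb_dot_ra (q : Fin 3 → ℤ) : ((q) ⨯₃ (if (q) 0 ≠ 0 ∨ (q) 1 ≠ 0 then (![(q) 1, -(q) 0, 0] : Fin 3 → ℤ) else (![0, (q) 2, -(q) 1] : Fin 3 → ℤ))) ⬝ᵥ (if (q) 0 ≠ 0 ∨ (q) 1 ≠ 0 then (![(q) 1, -(q) 0, 0] : Fin 3 → ℤ) else (![0, (q) 2, -(q) 1] : Fin 3 → ℤ)) = 0 := by
  rw [dotProduct_comm]; exact dot_cross_self q _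

/-- Real casts commute with the dot product. -/
theorem castR_dot (k l : Fin 3 → ℤ) : (fun i => ((k) i : ℝ)) ⬝ᵥ (fun i => ((l) i : ℝ)) = ((k ⬝ᵥ l : ℤ) : ℝ) := by
  simp [dotProduct]

/-- Real casts commute with the cross product. -/
theorem castR_cross (k l : Fin 3 → ℤ) : (fun i => (((k ⨯₃ l)) i : ℝ)) = (fun i => ((k) i : ℝ)) ⨯₃ (fun i => ((l) i : ℝ)) := by
  funext i
  fin_cases i <;> simp [cross_apply]

/-- `|k|²` is the dot square of the real cast. -/
theorem freqNormSq_eq_castR_dot (k : Fin 3 → ℤ) : Torus.freqNormSq k = (fun i => ((k) i : ℝ)) ⬝ᵥ (fun i => ((k) i : ℝ)) := by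
  simp [Torus.freqNormSq, dotProduct, sq]

/-- `|ra q|² ≤ |q|²`. -/
theorem freqNormSq_ra_le (q : Fin 3 → ℤ) : Torus.freqNormSq ((if (q) 0 ≠ 0 ∨ (q) 1 ≠ 0 then (![(q) 1, -(q) 0, 0] : Fin 3 → ℤ) else (![0, (q) 2, -(q) 1] : Fin 3 → ℤ))) ≤ Torus.freqNormSq q := by
  split_ifs <;> simp [Torus.freqNormSq, Fin.sum_univ_three] <;> nlinarith [sq_nonneg (q 0 : ℝ), sq_nonneg (q 2 : ℝ)]

/-- `|rb q|² = |q|² |ra q|²`. -/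
theorem freqNormSq_rb (q : Fin 3 → ℤ) :
    Torus.freqNormSq (((q) ⨯₃ (if (q) 0 ≠ 0 ∨ (q) 1 ≠ 0 then (![(q) 1, -(q) 0, 0] : Fin 3 → ℤ) else (![0, (q) 2, -(q) 1] : Fin 3 → ℤ)))) = Torus.freqNormSq q * Torus.freqNormSq ((if (q) 0 ≠ 0 ∨ (q) 1 ≠ 0 then (![(q) 1, -(q) 0, 0] : Fin 3 → ℤ) else (![0, (q) 2, -(q) 1] : Fin 3 → ℤ))) := by
  rw [freqNormSq_eq_castR_dot, freqNormSq_eq_castR_dot, freqNormSq_eq_castR_dot, castR_cross]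
  refine cross_self_dot _ _ ?_
  rw [castR_dot, ra_dot]; simp

/-- `rb q ≠ 0` for `q ≠ 0`. -/
theorem rb_ne_zero {q : Fin 3 → ℤ} (hq : q ≠ 0) : ((q) ⨯₃ (if (q) 0 ≠ 0 ∨ (q) 1 ≠ 0 then (![(q) 1, -(q) 0, 0] : Fin 3 → ℤ) else (![0, (q) 2, -(q) 1] : Fin 3 → ℤ))) ≠ 0 := by
  intro h
  have h1 : Torus.freqNormSq (((q) ⨯₃ (if (q) 0 ≠ 0 ∨ (q) 1 ≠ 0 then (![(q) 1, -(q) 0, 0] : Fin 3 → ℤ) else (![0, (q) 2, -(q) 1] : Fin 3 → ℤ)))) = 0 := by rw [h, Torus.freqNormSq_zero]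
  rw [freqNormSq_rb] at h1
  have hq1 := Torus.one_le_freqNormSq_of_ne_zero hq
  have hr1 := Torus.one_le_freqNormSq_of_ne_zero (ra_ne_zero hq)
  nlinarith

/-! ### Polarisation choice -/

/-- `|⟪g, B̂⟫|² = (Re g · B̂)² + (Im g · B̂)²` for a real vector `B̂`. -/
theorem norm_sq_inner_complexify (g : (EuclideanSpace ℂ (Fin 3))) (B : (EuclideanSpace ℝ (Fin 3))) :
    ‖⟪g, EuclideanSpace.complexify B⟫_ℂ‖ ^ 2 =
      (∑ j, (g j).re * B j) ^ 2 + (∑ j, (g j).im * B j) ^ 2 := by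
  have hre : (⟪g, EuclideanSpace.complexify B⟫_ℂ).re = ∑ j, (g j).re * B j := by
    simp [PiLp.inner_apply, Complex.re_sum, Complex.mul_re]
    exact Finset.sum_congr rfl fun _ _ => mul_comm _ _
  have him : (⟪g, EuclideanSpace.complexify B⟫_ℂ).im = -∑ j, (g j).im * B j := by
    simp [PiLp.inner_apply, Complex.im_sum, Complex.mul_im, Finset.sum_neg_distrib]
    exact Finset.sum_congr rfl fun _ _ => mul_comm _ _
  rw [Complex.sq_norm, Complex.normSq_apply, hre, him]
  ring

/-- `‖a‖² = a · a` for the Euclidean vector of a coordinate function. -/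
theorem norm_sq_toLp (a : Fin 3 → ℝ) : ‖(WithLp.toLp 2 a : (EuclideanSpace ℝ (Fin 3)))‖ ^ 2 = a ⬝ᵥ a := by
  rw [EuclideanSpace.norm_sq_eq]
  simp [dotProduct, sq]

/-- Real part of `dotc q g` as a real dot product. -/
theorem re_dotc (q : Fin 3 → ℤ) (g : (EuclideanSpace ℂ (Fin 3))) : (((fun j => ((q) j : ℂ)) ⬝ᵥ (WithLp.ofLp (g)))).re = (fun j => (g j).re) ⬝ᵥ (fun i => ((q) i : ℝ)) := by
  simp [dotProduct, Complex.re_sum, Complex.mul_re, mul_comm]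

/-- Imaginary part of `dotc q g` as a real dot product. -/
theorem im_dotc (q : Fin 3 → ℤ) (g : (EuclideanSpace ℂ (Fin 3))) : (((fun j => ((q) j : ℂ)) ⬝ᵥ (WithLp.ofLp (g)))).im = (fun j => (g j).im) ⬝ᵥ (fun i => ((q) i : ℝ)) := by
  simp [dotProduct, Complex.im_sum, Complex.mul_im, mul_comm]

/-- `‖g‖² = |Re g|² + |Im g|²` as real dot products. -/
theorem norm_sq_eq_dot (g : (EuclideanSpace ℂ (Fin 3))) :
    ‖g‖ ^ 2 = (fun j => (g j).re) ⬝ᵥ (fun j => (g j).re) + (fun j => (g j).im) ⬝ᵥ (fun j => (g j).im) := by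
  rw [EuclideanSpace.norm_sq_eq]
  simp only [Complex.sq_norm, Complex.normSq_apply, dotProduct, ← Finset.sum_add_distrib]

/-- The unit vector along a nonzero real vector, its norm and its pairings. -/
theorem unit_along (a : Fin 3 → ℝ) (ha : 0 < a ⬝ᵥ a) :
    ‖((Real.sqrt (a ⬝ᵥ a))⁻¹ • (WithLp.toLp 2 a : (EuclideanSpace ℝ (Fin 3))))‖ = 1 ∧
      ∀ w : Fin 3 → ℝ, (∑ j, w j * ((Real.sqrt (a ⬝ᵥ a))⁻¹ • (WithLp.toLp 2 a : (EuclideanSpace ℝ (Fin 3)))) j) =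
        (Real.sqrt (a ⬝ᵥ a))⁻¹ * (w ⬝ᵥ a) := by
  have hs : 0 < Real.sqrt (a ⬝ᵥ a) := Real.sqrt_pos.2 ha
  constructor
  · rw [norm_smul, norm_inv, Real.norm_of_nonneg hs.le]
    have h1 : ‖(WithLp.toLp 2 a : (EuclideanSpace ℝ (Fin 3)))‖ = Real.sqrt (a ⬝ᵥ a) := by
      rw [← Real.sqrt_sq (norm_nonneg _), norm_sq_toLp]
    rw [h1, inv_mul_cancel₀ hs.ne']
  · intro w
    simp only [PiLp.smul_apply, smul_eq_mul, dotProduct, Finset.mul_sum]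
    exact Finset.sum_congr rfl fun j _ => by ring

set_option maxHeartbeats 400000 in
/-- **Polarisation choice.** For `q ≠ 0` and a complex vector `g ⊥ q` there is an integer direction
`r ⊥ q` (of length `≤ |q|²`) and a real unit vector `B ⊥ r, q` capturing half of `‖g‖²`. -/
theorem frame_selection {q : Fin 3 → ℤ} (hq : q ≠ 0) (g : (EuclideanSpace ℂ (Fin 3))) (hg : ((fun j => ((q) j : ℂ)) ⬝ᵥ (WithLp.ofLp (g))) = 0) :
    ∃ (r : Fin 3 → ℤ) (B : (EuclideanSpace ℝ (Fin 3))), r ≠ 0 ∧ r ⬝ᵥ q = 0 ∧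
      Torus.freqNormSq r ≤ Torus.freqNormSq q ^ 2 ∧ ‖B‖ = 1 ∧
      (∑ j, (r j : ℝ) * B j) = 0 ∧ (∑ j, (q j : ℝ) * B j) = 0 ∧
      ‖g‖ ^ 2 ≤ 2 * ‖⟪g, EuclideanSpace.complexify B⟫_ℂ‖ ^ 2 := by
  set a : Fin 3 → ℝ := (fun i => ((((if (q) 0 ≠ 0 ∨ (q) 1 ≠ 0 then (![(q) 1, -(q) 0, 0] : Fin 3 → ℤ) else (![0, (q) 2, -(q) 1] : Fin 3 → ℤ)))) i : ℝ)) with ha_def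
  set b : Fin 3 → ℝ := (fun i => (((((q) ⨯₃ (if (q) 0 ≠ 0 ∨ (q) 1 ≠ 0 then (![(q) 1, -(q) 0, 0] : Fin 3 → ℤ) else (![0, (q) 2, -(q) 1] : Fin 3 → ℤ))))) i : ℝ)) with hb_def
  set gR : Fin 3 → ℝ := fun j => (g j).re with hgR
  set gI : Fin 3 → ℝ := fun j => (g j).im with hgI
  have hb : b = (fun i => ((q) i : ℝ)) ⨯₃ a := by rw [hb_def, castR_cross]
  have haq : a ⬝ᵥ (fun i => ((q) i : ℝ)) = 0 := by rw [ha_def, castR_dot, ra_dot]; simp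
  have hbq : b ⬝ᵥ (fun i => ((q) i : ℝ)) = 0 := by rw [hb_def, castR_dot, rb_dot_q]; simp
  have hba : b ⬝ᵥ a = 0 := by rw [hb_def, ha_def, castR_dot, rb_dot_ra]; simp
  have hvR : gR ⬝ᵥ (fun i => ((q) i : ℝ)) = 0 := by
    have h := congrArg Complex.re hg
    rw [re_dotc, Complex.zero_re] at h
    exact h
  have hvI : gI ⬝ᵥ (fun i => ((q) i : ℝ)) = 0 := by
    have h := congrArg Complex.im hg
    rw [im_dotc, Complex.zero_im] at h
    exact h
  have hA2 : 0 < a ⬝ᵥ a := by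
    rw [ha_def, ← freqNormSq_eq_castR_dot]
    exact lt_of_lt_of_le one_pos (Torus.one_le_freqNormSq_of_ne_zero (ra_ne_zero hq))
  have hB2 : 0 < b ⬝ᵥ b := by
    rw [hb_def, ← freqNormSq_eq_castR_dot]
    exact lt_of_lt_of_le one_pos (Torus.one_le_freqNormSq_of_ne_zero (rb_ne_zero hq))
  have FR := frame_identity gR ((fun i => ((q) i : ℝ))) a hvR haq
  have FI := frame_identity gI ((fun i => ((q) i : ℝ))) a hvI haq
  rw [← hb] at FR FI
  have hng : ‖g‖ ^ 2 = gR ⬝ᵥ gR + gI ⬝ᵥ gI := norm_sq_eq_dot g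
  have hfq1 : 1 ≤ Torus.freqNormSq q := Torus.one_le_freqNormSq_of_ne_zero hq
  by_cases hcase : (gR ⬝ᵥ b) ^ 2 * (a ⬝ᵥ a) + (gI ⬝ᵥ b) ^ 2 * (a ⬝ᵥ a) ≤
      (gR ⬝ᵥ a) ^ 2 * (b ⬝ᵥ b) + (gI ⬝ᵥ a) ^ 2 * (b ⬝ᵥ b)
  · -- polarisation along `a = ra q`, wave direction `r = rb q`
    obtain ⟨hBn, hBw⟩ := unit_along a hA2
    refine ⟨((q) ⨯₃ (if (q) 0 ≠ 0 ∨ (q) 1 ≠ 0 then (![(q) 1, -(q) 0, 0] : Fin 3 → ℤ) else (![0, (q) 2, -(q) 1] : Fin 3 → ℤ))), (Real.sqrt (a ⬝ᵥ a))⁻¹ • (WithLp.toLp 2 a : (EuclideanSpace ℝ (Fin 3))), rb_ne_zero hq, rb_dot_q q, ?_,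
      hBn, ?_, ?_, ?_⟩
    · rw [freqNormSq_rb, sq]
      exact mul_le_mul_of_nonneg_left (freqNormSq_ra_le q) (Torus.freqNormSq_nonneg q)
    · exact (hBw b).trans (by rw [hba, mul_zero])
    · exact (hBw ((fun i => ((q) i : ℝ)))).trans (by rw [dotProduct_comm ((fun i => ((q) i : ℝ))) a, haq, mul_zero])
    · rw [norm_sq_inner_complexify]
      rw [show (∑ j, (g j).re * ((Real.sqrt (a ⬝ᵥ a))⁻¹ • (WithLp.toLp 2 a : (EuclideanSpace ℝ (Fin 3)))) j) =
          (Real.sqrt (a ⬝ᵥ a))⁻¹ * (gR ⬝ᵥ a) from hBw gR,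
        show (∑ j, (g j).im * ((Real.sqrt (a ⬝ᵥ a))⁻¹ • (WithLp.toLp 2 a : (EuclideanSpace ℝ (Fin 3)))) j) =
          (Real.sqrt (a ⬝ᵥ a))⁻¹ * (gI ⬝ᵥ a) from hBw gI, hng]
      have hc2 : ((Real.sqrt (a ⬝ᵥ a))⁻¹) ^ 2 * (a ⬝ᵥ a) = 1 := by
        rw [inv_pow, Real.sq_sqrt hA2.le, inv_mul_cancel₀ hA2.ne']
      have key : (gR ⬝ᵥ gR + gI ⬝ᵥ gI) * (a ⬝ᵥ a) * (b ⬝ᵥ b) ≤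
          2 * ((gR ⬝ᵥ a) ^ 2 + (gI ⬝ᵥ a) ^ 2) * (b ⬝ᵥ b) := by nlinarith [FR, FI, hcase]
      have key2 : (gR ⬝ᵥ gR + gI ⬝ᵥ gI) * (a ⬝ᵥ a) ≤ 2 * ((gR ⬝ᵥ a) ^ 2 + (gI ⬝ᵥ a) ^ 2) :=
        le_of_mul_le_mul_right (by nlinarith [key]) hB2
      nlinarith [key2, hc2, sq_nonneg (gR ⬝ᵥ a), sq_nonneg (gI ⬝ᵥ a), hA2]
  · -- polarisation along `b = rb q`, wave direction `r = ra q`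
    push Not at hcase
    obtain ⟨hBn, hBw⟩ := unit_along b hB2
    refine ⟨(if (q) 0 ≠ 0 ∨ (q) 1 ≠ 0 then (![(q) 1, -(q) 0, 0] : Fin 3 → ℤ) else (![0, (q) 2, -(q) 1] : Fin 3 → ℤ)), (Real.sqrt (b ⬝ᵥ b))⁻¹ • (WithLp.toLp 2 b : (EuclideanSpace ℝ (Fin 3))), ra_ne_zero hq, ra_dot q, ?_,
      hBn, ?_, ?_, ?_⟩
    · calc Torus.freqNormSq ((if (q) 0 ≠ 0 ∨ (q) 1 ≠ 0 then (![(q) 1, -(q) 0, 0] : Fin 3 → ℤ) else (![0, (q) 2, -(q) 1] : Fin 3 → ℤ))) ≤ Torus.freqNormSq q := freqNormSq_ra_le q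
        _ ≤ Torus.freqNormSq q ^ 2 := by nlinarith
    · exact (hBw a).trans (by rw [dotProduct_comm a b, hba, mul_zero])
    · exact (hBw ((fun i => ((q) i : ℝ)))).trans (by rw [dotProduct_comm ((fun i => ((q) i : ℝ))) b, hbq, mul_zero])
    · rw [norm_sq_inner_complexify]
      rw [show (∑ j, (g j).re * ((Real.sqrt (b ⬝ᵥ b))⁻¹ • (WithLp.toLp 2 b : (EuclideanSpace ℝ (Fin 3)))) j) =
          (Real.sqrt (b ⬝ᵥ b))⁻¹ * (gR ⬝ᵥ b) from hBw gR,
        show (∑ j, (g j).im * ((Real.sqrt (b ⬝ᵥ b))⁻¹ • (WithLp.toLp 2 b : (EuclideanSpace ℝ (Fin 3)))) j) =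
          (Real.sqrt (b ⬝ᵥ b))⁻¹ * (gI ⬝ᵥ b) from hBw gI, hng]
      have hc2 : ((Real.sqrt (b ⬝ᵥ b))⁻¹) ^ 2 * (b ⬝ᵥ b) = 1 := by
        rw [inv_pow, Real.sq_sqrt hB2.le, inv_mul_cancel₀ hB2.ne']
      have key : (gR ⬝ᵥ gR + gI ⬝ᵥ gI) * (a ⬝ᵥ a) * (b ⬝ᵥ b) ≤
          2 * ((gR ⬝ᵥ b) ^ 2 + (gI ⬝ᵥ b) ^ 2) * (a ⬝ᵥ a) := by nlinarith [FR, FI, hcase]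
      have key2 : (gR ⬝ᵥ gR + gI ⬝ᵥ gI) * (b ⬝ᵥ b) ≤ 2 * ((gR ⬝ᵥ b) ^ 2 + (gI ⬝ᵥ b) ^ 2) :=
        le_of_mul_le_mul_right (by nlinarith [key]) hA2
      nlinarith [key2, hc2, sq_nonneg (gR ⬝ᵥ b), sq_nonneg (gI ⬝ᵥ b), hB2]

/-! ### Unresolved wave frequencies -/

/-- Parallelogram bound `|a|² ≤ 2|a + b|² + 2|b|²`. -/
theorem freqNormSq_le_two_mul (a b : Fin 3 → ℤ) :
    Torus.freqNormSq a ≤ 2 * Torus.freqNormSq (a + b) + 2 * Torus.freqNormSq b := by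
  simp only [Torus.freqNormSq, Finset.mul_sum, ← Finset.sum_add_distrib, Pi.add_apply, Int.cast_add]
  exact Finset.sum_le_sum fun i _ => by nlinarith [sq_nonneg ((a i : ℝ) + 2 * b i)]

/-- Real casts are additive. -/
theorem castR_add (a b : Fin 3 → ℤ) : (fun i => (((a + b)) i : ℝ)) = (fun i => ((a) i : ℝ)) + (fun i => ((b) i : ℝ)) := by
  funext i; simp

/-- Pythagoras: `|a + b|² = |a|² + |b|²` for `a ⊥ b`. -/
theorem freqNormSq_add_of_dot_eq_zero (a b : Fin 3 → ℤ) (h : a ⬝ᵥ b = 0) :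
    Torus.freqNormSq (a + b) = Torus.freqNormSq a + Torus.freqNormSq b := by
  rw [freqNormSq_eq_castR_dot, freqNormSq_eq_castR_dot, freqNormSq_eq_castR_dot]
  have hab : (fun i => ((a) i : ℝ)) ⬝ᵥ (fun i => ((b) i : ℝ)) = 0 := by rw [castR_dot, h]; simp
  rw [castR_add, add_dotProduct, dotProduct_add, dotProduct_add, dotProduct_comm ((fun i => ((b) i : ℝ))) ((fun i => ((a) i : ℝ))),
    hab]
  ring

/-- Polarisation: `|a + b|² = |a|² + |b|² + 2 a·b`. -/
theorem freqNormSq_add_self_dot (a b : Fin 3 → ℤ) :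
    Torus.freqNormSq (a + b) = Torus.freqNormSq a + Torus.freqNormSq b + 2 * ((fun i => ((a) i : ℝ)) ⬝ᵥ (fun i => ((b) i : ℝ))) := by
  rw [freqNormSq_eq_castR_dot, freqNormSq_eq_castR_dot, freqNormSq_eq_castR_dot, castR_add,
    add_dotProduct, dotProduct_add, dotProduct_add, dotProduct_comm ((fun i => ((b) i : ℝ))) ((fun i => ((a) i : ℝ)))]
  ring

/-- `|t r|² = t² |r|²`. -/
theorem freqNormSq_natMul (t : ℕ) (r : Fin 3 → ℤ) :
    Torus.freqNormSq (fun i => (t : ℤ) * r i) = (t : ℝ) ^ 2 * Torus.freqNormSq r := by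
  simp [Torus.freqNormSq, Finset.mul_sum, mul_pow]

/-- `(t r) · q = t (r · q)`. -/
theorem natMul_dot (t : ℕ) (r q : Fin 3 → ℤ) : (fun i => (t : ℤ) * r i) ⬝ᵥ q = (t : ℤ) * (r ⬝ᵥ q) := by
  simp [dotProduct, Finset.mul_sum, mul_assoc]

/-- Squaring is monotone on nonnegative reals. -/
theorem numeric_sq_mono {x y : ℝ} (hx : 0 ≤ x) (hxy : x ≤ y) : x ^ 2 ≤ y ^ 2 :=
  pow_le_pow_left₀ hx hxy 2

/-- `(N² + 2N + 4)² + N² ≤ (N² + 2N + 5)²` for `N ≥ 0`. -/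
theorem numeric_bound_one (N : ℝ) (hN : 0 ≤ N) :
    (N ^ 2 + 2 * N + 4) ^ 2 + N ^ 2 ≤ (N ^ 2 + 2 * N + 5) ^ 2 := by
  nlinarith

/-- **Wave frequencies.** Given the beat frequency `q` in the ball of radius `N` and a lattice
direction `r ⊥ q` of length `≤ |q|²`, there is a multiple `p` of `r` with `p ⊥ q` such that
`p`, `p' = p + q` and all their combinations with the shear frequency `±e₂` lie outside the ball,
while `|p|, |p'| ≤ N² + 2N + 5`. -/
theorem wave_frequencies (N : ℕ) {q r : Fin 3 → ℤ} (hqN : Torus.freqNormSq q ≤ (N : ℝ) ^ 2)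
    (hr : r ≠ 0) (hrq : r ⬝ᵥ q = 0) (hrq2 : Torus.freqNormSq r ≤ Torus.freqNormSq q ^ 2) :
    ∃ (t : ℕ) (p : Fin 3 → ℤ), p = (fun i => (t : ℤ) * r i) ∧ p ⬝ᵥ q = 0 ∧
      (N : ℝ) ^ 2 < Torus.freqNormSq p ∧ (N : ℝ) ^ 2 < Torus.freqNormSq (p + q) ∧
      (N : ℝ) ^ 2 < Torus.freqNormSq (p + (![0, 1, 0] : Fin 3 → ℤ)) ∧ (N : ℝ) ^ 2 < Torus.freqNormSq (p - (![0, 1, 0] : Fin 3 → ℤ)) ∧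
      (N : ℝ) ^ 2 < Torus.freqNormSq (p + q + (![0, 1, 0] : Fin 3 → ℤ)) ∧ (N : ℝ) ^ 2 < Torus.freqNormSq (p + q - (![0, 1, 0] : Fin 3 → ℤ)) ∧
      (N : ℝ) ^ 2 < Torus.freqNormSq (p + (p + q)) ∧
      Torus.freqNormSq p ≤ ((N ^ 2 + 2 * N + 5 : ℕ) : ℝ) ^ 2 ∧
      Torus.freqNormSq (p + q) ≤ ((N ^ 2 + 2 * N + 5 : ℕ) : ℝ) ^ 2 := by
  have hR1 : 1 ≤ Torus.freqNormSq r := Torus.one_le_freqNormSq_of_ne_zero hr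
  have hRpos : 0 < Torus.freqNormSq r := lt_of_lt_of_le one_pos hR1
  have hsq : 0 < Real.sqrt (Torus.freqNormSq r) := Real.sqrt_pos.2 hRpos
  let t : ℕ := ⌈(2 * (N : ℝ) + 4) / Real.sqrt (Torus.freqNormSq r)⌉₊
  let p : Fin 3 → ℤ := fun i => (t : ℤ) * r i
  have hpq : p ⬝ᵥ q = 0 := by
    show (fun i => (t : ℤ) * r i) ⬝ᵥ q = 0
    rw [natMul_dot, hrq, mul_zero]
  have hpn : Torus.freqNormSq p = ((t : ℝ) * Real.sqrt (Torus.freqNormSq r)) ^ 2 := by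
    show Torus.freqNormSq (fun i => (t : ℤ) * r i) = _
    rw [freqNormSq_natMul, mul_pow, Real.sq_sqrt hRpos.le]
  -- lower bound: `2N+4 ≤ |p|`
  have hlow' : 2 * (N : ℝ) + 4 ≤ (t : ℝ) * Real.sqrt (Torus.freqNormSq r) := by
    have ht1 : (2 * (N : ℝ) + 4) / Real.sqrt (Torus.freqNormSq r) ≤ t := Nat.le_ceil _
    rwa [div_le_iff₀ hsq] at ht1
  have hN0 : (0 : ℝ) ≤ N := Nat.cast_nonneg N
  have hlow : 4 * (N : ℝ) ^ 2 + 16 * N + 16 ≤ Torus.freqNormSq p := by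
    rw [hpn, show 4 * (N : ℝ) ^ 2 + 16 * N + 16 = (2 * (N : ℝ) + 4) ^ 2 by ring]
    exact numeric_sq_mono (by positivity) hlow'
  -- upper bound: `|p| < 2N + 4 + |r| ≤ N² + 2N + 4`
  have hsqrt_le : Real.sqrt (Torus.freqNormSq r) ≤ (N : ℝ) ^ 2 := by
    calc Real.sqrt (Torus.freqNormSq r) ≤ Real.sqrt (Torus.freqNormSq q ^ 2) :=
          Real.sqrt_le_sqrt hrq2
      _ = Torus.freqNormSq q := Real.sqrt_sq (Torus.freqNormSq_nonneg q)
      _ ≤ (N : ℝ) ^ 2 := hqN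
  have hup : Torus.freqNormSq p ≤ ((N : ℝ) ^ 2 + 2 * N + 4) ^ 2 := by
    have ht2 : (t : ℝ) < (2 * (N : ℝ) + 4) / Real.sqrt (Torus.freqNormSq r) + 1 :=
      Nat.ceil_lt_add_one (by positivity)
    have hup' : (t : ℝ) * Real.sqrt (Torus.freqNormSq r) <
        2 * (N : ℝ) + 4 + Real.sqrt (Torus.freqNormSq r) := by
      have := mul_lt_mul_of_pos_right ht2 hsq
      rwa [add_mul, one_mul, div_mul_cancel₀ _ hsq.ne'] at this
    rw [hpn]
    exact numeric_sq_mono (by positivity) (by linarith)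
  have hpq_norm : Torus.freqNormSq (p + q) = Torus.freqNormSq p + Torus.freqNormSq q :=
    freqNormSq_add_of_dot_eq_zero p q hpq
  have hq0 : 0 ≤ Torus.freqNormSq q := Torus.freqNormSq_nonneg q
  have he2 : Torus.freqNormSq (![0, 1, 0] : Fin 3 → ℤ) = 1 := freqNormSq_e2
  have hme2 : Torus.freqNormSq (-(![0, 1, 0] : Fin 3 → ℤ)) = 1 := by rw [Torus.freqNormSq_neg, he2]
  -- parallelogram lower bounds
  have P1 := freqNormSq_le_two_mul p (![0, 1, 0] : Fin 3 → ℤ)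
  have P2 := freqNormSq_le_two_mul p (-(![0, 1, 0] : Fin 3 → ℤ))
  have P3 := freqNormSq_le_two_mul (p + q) (![0, 1, 0] : Fin 3 → ℤ)
  have P4 := freqNormSq_le_two_mul (p + q) (-(![0, 1, 0] : Fin 3 → ℤ))
  rw [he2] at P1 P3
  rw [hme2, ← sub_eq_add_neg] at P2 P4
  rw [hpq_norm] at P3 P4
  have hpp : Torus.freqNormSq (p + (p + q)) =
      Torus.freqNormSq p + Torus.freqNormSq (p + q) + 2 * ((fun i => ((p) i : ℝ)) ⬝ᵥ (fun i => (((p + q)) i : ℝ))) :=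
    freqNormSq_add_self_dot p (p + q)
  have hdot : (fun i => ((p) i : ℝ)) ⬝ᵥ (fun i => (((p + q)) i : ℝ)) = Torus.freqNormSq p := by
    rw [castR_add, dotProduct_add, ← freqNormSq_eq_castR_dot, castR_dot, hpq]; simp
  rw [hdot, hpq_norm] at hpp
  have hcast : (((N ^ 2 + 2 * N + 5 : ℕ) : ℝ)) = (N : ℝ) ^ 2 + 2 * N + 5 := by push_cast; ring
  have hnum := numeric_bound_one (N : ℝ) hN0
  have hsqN : 0 ≤ (N : ℝ) ^ 2 := sq_nonneg _
  refine ⟨t, p, rfl, hpq, ?_, ?_, ?_, ?_, ?_, ?_, ?_, ?_, ?_⟩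
  · linarith
  · rw [hpq_norm]; linarith
  · linarith
  · linarith
  · linarith
  · linarith
  · rw [hpp]; linarith
  · rw [hcast]; linarith
  · rw [hcast, hpq_norm]; linarith

end Summit.AnomalousDissipation.AnomalousDissipation.Theorems.TaylorCertificatePair.Negative
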